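import Literature.AnabelianGeometry.SemiGraphs.SubdivisionLemmas
import Mathlib.Combinatorics.SimpleGraph.Paths
import HarnessLib

/-!
# Folding of a path of the barycentric subdivision under a morphism of semi-graphs

Mochizuki, *Semi-graphs of anabelioids*, Publ. RIMS **42** (2006), §1 pp. 11–14 (semi-graphs, their
morphisms, immersions: "the induced map from branches abutting to `v_A` to branches abutting to `v_B`
is injective") and §3, proof of Theorem 3.7 (iii) p. 41 with the author's *Comments* (2020) (6)(b)
("there exists a pair of distinct edges `e_i, e'_i ∈ E_i` whose respective images … are distinct … we
may assume … that the pair `{e_i, e'_i}` … forms a subjoint") [cite: MochizukiSemiAnbd2006, Thm 3.7(iii) p.41].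

PROOF-ONLY combinatorial brick (cell abc-iut, layer L3, row T37iii·LOCFIN-PERSIST of seat
abc-iut-w6-d066; no definition).  A morphism `φ : T ⟶ T'` of semi-graphs *folds* a pair of distinct
branches `c ≠ c'` abutting to one vertex `w` of `T` if `φ c = φ c'`.  Walking along a path
`u – c₀ – f₀ – c₁ – w₁ – c₂ – f₁ – …  – x` of the subdivision of `T` (vertex-, branch- and edge-points)
from a vertex `u` to a vertex `x`: as long as `φ` folds the consecutive pairs `(c₁,c₂), (c₃,c₄), …` at
the interior vertices, all the edges `f₀, f₁, …` have the same image, so every vertex met so far maps to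
an END-VERTEX of the image edge of `f₀`.  Hence (`exists_endpoint_or_unfolded_of_isPath`): EITHER the
end-vertex `x` maps to an end-vertex of the edge of `φ c₀`, OR some interior vertex `w` of the path
carries an UNFOLDED pair of consecutive (distinct) branches of the path and maps to an end-vertex of that
same edge.  A predicate `P` on nodes known along the path (e.g. "fixed by a compact group") is carried to
the branches of the pair.  This is the localisation device of the seat's desk memo (first unfolded subjoint
along a fixed geodesic lies next to the image of its origin).  Nothing here bears on [IUTchIII] Cor. 3.12.
-/

namespace Literature.AnabelianGeometry.SemiGraphs

namespace SemiGraph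

universe u

variable {T T' : SemiGraph.{u}} (φ : T ⟶ T') (P : T.Node → Prop)

/-- **Folding along a path of the subdivision.**  Let `p` be a path of positive length in the subdivision
of `T` from the vertex-point `u` to the vertex-point `x`, all of whose nodes satisfy `P`, and let `c₀`
(abutting to `u`) be its first branch-point.  Then there is a vertex-point `w` of `p` mapped by `φ` to an
end-vertex of the edge of `φ c₀` such that either `w = x`, or `w` carries two distinct branches `c ≠ c'`
abutting to it, both satisfying `P`, NOT folded by `φ` (`φ c ≠ φ c'`).
[cite: MochizukiSemiAnbd2006, Thm 3.7(iii) p.41] -/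
theorem exists_endpoint_or_unfolded_of_isPath :
    ∀ (n : ℕ) {u x : T.Vertex} (p : T.subdivision.Walk (Sum.inl u) (Sum.inl x)),
      p.length = n → p.IsPath → 0 < p.length → (∀ z ∈ p.support, P z) →
      ∃ (c₀ : T.Branch) (w : T.Vertex), p.getVert 1 = Sum.inr (Sum.inr c₀) ∧
        T.abuts c₀ = some u ∧ P (Sum.inr (Sum.inr c₀)) ∧ Sum.inl w ∈ p.support ∧
        (∃ d : T'.Branch, T'.edgeOf d = T'.edgeOf (φ.branchMap c₀) ∧
          T'.abuts d = some (φ.vertexMap w)) ∧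
        (w = x ∨ ∃ c c' : T.Branch, c ≠ c' ∧ T.abuts c = some w ∧ T.abuts c' = some w ∧
          P (Sum.inr (Sum.inr c)) ∧ P (Sum.inr (Sum.inr c')) ∧ φ.branchMap c ≠ φ.branchMap c') := by
  intro n
  induction n using Nat.strong_induction_on with
  | _ n ih =>
  intro u x p hlen hp hpos hP
  -- step 1: `u – c₀`
  cases p with
  | nil => simp at hpos
  | cons h₁ p₁ =>
  rename_i n₁
  obtain ⟨c₀, hc₀u, rfl⟩ := (T.subdivision_adj_inl_iff u n₁).mp h₁
  have hp₁ : p₁.IsPath ∧ Sum.inl u ∉ p₁.support := (SimpleGraph.Walk.cons_isPath_iff _ _).mp hp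
  have hPc₀ : P (Sum.inr (Sum.inr c₀)) := hP _ (by simp)
  -- step 2: `c₀ – f₀`, `f₀ = edgeOf c₀`
  cases p₁ with
  | cons h₂ p₂ =>
  rename_i n₂
  rcases (T.subdivision_adj_branch_iff c₀ n₂).mp h₂ with rfl | ⟨v, hv, rfl⟩
  swap
  · -- back to the vertex `u`: excluded by the path condition
    exfalso
    have hvu : v = u := Option.some_injective _ (hv.symm.trans hc₀u)
    subst hvu
    exact hp₁.2 (by simp)
  have hp₂ : p₂.IsPath ∧ Sum.inr (Sum.inr c₀) ∉ p₂.support :=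
    (SimpleGraph.Walk.cons_isPath_iff _ _).mp hp₁.1
  -- step 3: `f₀ – c₁`, `c₁` a branch of `f₀`, `c₁ ≠ c₀`
  cases p₂ with
  | cons h₃ p₃ =>
  rename_i n₃
  obtain ⟨c₁, hc₁e, rfl⟩ := (T.subdivision_adj_edge_iff (T.edgeOf c₀) n₃).mp h₃
  have hp₃ : p₃.IsPath ∧ Sum.inr (Sum.inl (T.edgeOf c₀)) ∉ p₃.support :=
    (SimpleGraph.Walk.cons_isPath_iff _ _).mp hp₂.1
  -- step 4: `c₁ – w₁`
  cases p₃ with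
  | cons h₄ p₄ =>
  rename_i n₄
  rcases (T.subdivision_adj_branch_iff c₁ n₄).mp h₄ with rfl | ⟨w₁, hw₁, rfl⟩
  · -- back to the edge-point `f₀`: excluded by the path condition
    exfalso
    refine hp₃.2 ?_
    rw [SimpleGraph.Walk.support_cons]
    refine List.mem_cons_of_mem _ ?_
    rw [← hc₁e]
    exact SimpleGraph.Walk.start_mem_support _
  have hp₄ : p₄.IsPath ∧ Sum.inr (Sum.inr c₁) ∉ p₄.support :=
    (SimpleGraph.Walk.cons_isPath_iff _ _).mp hp₃.1
  -- bookkeeping: nodes of `p₄` are nodes of `p`, and `P` holds along `p₄`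
  have hsupp : ∀ z, z ∈ p₄.support →
      z ∈ (SimpleGraph.Walk.cons h₁ (SimpleGraph.Walk.cons h₂ (SimpleGraph.Walk.cons h₃
        (SimpleGraph.Walk.cons h₄ p₄)))).support := by
    intro z hz
    simp only [SimpleGraph.Walk.support_cons, List.mem_cons]
    exact Or.inr (Or.inr (Or.inr (Or.inr hz)))
  have hP₄ : ∀ z ∈ p₄.support, P z := fun z hz => hP z (hsupp z hz)
  have hPc₁ : P (Sum.inr (Sum.inr c₁)) := hP _ (by simp)
  -- the end-vertex `φ w₁` of the image edge of `f₀`, through `φ c₁`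
  have hend₁ : ∃ d : T'.Branch, T'.edgeOf d = T'.edgeOf (φ.branchMap c₀) ∧
      T'.abuts d = some (φ.vertexMap w₁) :=
    ⟨φ.branchMap c₁, by rw [φ.edgeOf_branchMap, φ.edgeOf_branchMap, hc₁e],
      φ.abuts_branchMap c₁ w₁ hw₁⟩
  have hget : (SimpleGraph.Walk.cons h₁ (SimpleGraph.Walk.cons h₂ (SimpleGraph.Walk.cons h₃
      (SimpleGraph.Walk.cons h₄ p₄)))).getVert 1 = Sum.inr (Sum.inr c₀) := by
    simp [SimpleGraph.Walk.getVert_cons_succ]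
  -- case: the path ends at `w₁`
  cases p₄ with
  | nil =>
    exact ⟨c₀, _, hget, hc₀u, hPc₀, by simp, hend₁, Or.inl rfl⟩
  | cons h₅ p₅ =>
  rename_i n₅
  -- step 5: `w₁ – c₂`, `c₂ ≠ c₁`
  obtain ⟨c₂, hc₂w, rfl⟩ := (T.subdivision_adj_inl_iff w₁ n₅).mp h₅
  have hc₁₂ : c₁ ≠ c₂ := by
    rintro rfl
    exact hp₄.2 (by simp)
  have hPc₂ : P (Sum.inr (Sum.inr c₂)) := hP₄ _ (by simp)
  by_cases hfold : φ.branchMap c₁ = φ.branchMap c₂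
  · -- folded at `w₁`: induct on the remaining path from `w₁`, whose first branch is `c₂`
    have hlen₅ : (SimpleGraph.Walk.cons h₅ p₅).length = n - 4 := by
      simp only [SimpleGraph.Walk.length_cons] at hlen ⊢
      omega
    have hlt : n - 4 < n := by
      simp only [SimpleGraph.Walk.length_cons] at hlen
      omega
    obtain ⟨c₀', w, hget', -, -, hwsupp, ⟨d, hde, hdw⟩, hw⟩ :=
      ih (n - 4) hlt (SimpleGraph.Walk.cons h₅ p₅) hlen₅ hp₄.1 (by simp) hP₄
    have hc₀' : c₀' = c₂ := by
      have e₁ : (SimpleGraph.Walk.cons h₅ p₅).getVert 1 = Sum.inr (Sum.inr c₂) := by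
        simp [SimpleGraph.Walk.getVert_cons_succ]
      rw [e₁] at hget'
      simpa using hget'.symm
    subst hc₀'
    refine ⟨c₀, w, hget, hc₀u, hPc₀, hsupp _ hwsupp, ⟨d, ?_, hdw⟩, hw⟩
    -- the image edge of `c₂` is that of `c₁`, i.e. of `f₀`, i.e. of `c₀`
    rw [hde, ← hfold, φ.edgeOf_branchMap, φ.edgeOf_branchMap, hc₁e]
  · -- unfolded at `w₁`
    exact ⟨c₀, w₁, hget, hc₀u, hPc₀, hsupp _ (by simp), hend₁,
      Or.inr ⟨c₁, c₂, hc₁₂, hw₁, hc₂w, hPc₁, hPc₂, hfold⟩⟩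

end SemiGraph

end Literature.AnabelianGeometry.SemiGraphs
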